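import Summits.CriticalPhenomena.PercolationContinuityZ3.Theorems.PercNearOneGluingNoHeavyLowerTailSahiCTCLadderThreeRowFourPrep
import HarnessLib

/-!
# `NoHeavyLowerTail` (crux stmt-CriticalPhenomena-4575), P3 lane: the row `#dbl = 4` of the level-3 ladder `(L_3)`

Support file (seat `prim-l12-p3`, gen 26; `--supports stmt-CriticalPhenomena-4575`).  Memo g26 §4.5.  For 3-live up-sets `𝒳, 𝒵` and a profile
`m ≤ 2` with doubled set `D` of size `4` and single set `T` of size `τ ≥ 2`, the coefficient of
`L_3 = e_3·(Π·GF(𝒳∩𝒵) − GF(𝒳)GF(𝒵)) − Θ_2·e_{≥3}·GF(W_3)` at `m` is nonnegative (`coeff_ladder_three_rowFour_nonneg`).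
Proof: the charge is at most `(τ+4)·A + Σ_p c_p` (`A` = common 3-subsets of `D`, `c_p` = common 3-sets `p + y`, `y ∈ T`, for the six pairs
`p ⊆ D`); the surplus side contains the four 2-live cubes `link_d` on `(D∖d) ∪ T` and the `6τ` 1-live cubes `link_p` on `(D∖p) ∪ (T∖y)`; LOOP on
the 1-live cubes pays `c_p` for uncovered and `τ` for covered pairs, DEG (averaged over the covered pairs at `d`) resp. TRIANGLE (when all four
3-subsets of `D` are common) bounds the 2-live cubes, and `#{covered pairs} = 3A − C(A,2) ≥ 2A` (A ≤ 3) closes the accounting.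
With `…LadderThreeReduction` the ladder `(L_3)` is thereby reduced to the rows `#dbl ∈ {1,2,3}` (and `#dbl = 4` with `τ ≤ 1`, i.e. `≤ 5` points,
inside the exhaustive k = 5 census).  Nothing is asserted about the crux.
-/

namespace Summit.CriticalPhenomena.PercolationContinuityZ3.Theorems.SahiCTCForms

open Finset MvPolynomial SahiCTCGenFun SahiCTCWeightedLYM

variable {α : Type*} [DecidableEq α] [Fintype α]

section RowFourMain
variable {𝒳 𝒵 : Finset (Finset α)}

/-! #### The charge of the row -/

/-- **Charge bound in the row `#dbl = 4`**: `[m](Θ_2·e_{≥3}·GF(W)) ≤ (τ+4)·#{w ∈ W : w ⊆ D} + #{w ∈ W : w ⊆ supp m, #(D ∩ w) = 2}` for a family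
`W` of 3-sets (`D = dbl m`, `τ = #(lev m 1)`, `m ≤ 2`, `#D = 4`, `τ ≥ 1`). [this work] -/
theorem coeff_chargeT_rowFour_le {m : α →₀ ℕ} (hm : ∀ i, m i ≤ 2) (hD : #(dbl m) = 4) (hτ : 1 ≤ #(lev m 1))
    (W : Finset (Finset α)) (hW : ∀ w ∈ W, #w = 3) :
    (gf (bySize (· ≤ 3 - 1) : Finset (Finset α)) * gf (bySize (3 ≤ ·) : Finset (Finset α)) * gf W).coeff m ≤
      ((#(lev m 1) : ℤ) + 4) * #(W.filter fun w => w ⊆ dbl m) +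
        #((W.filter fun w => ind w ≤ m).filter fun w => #(dbl m ∩ w) = 2) := by
  rw [coeff_chargeT_eq_sum]
  set Wm := W.filter fun w => ind w ≤ m
  have hval : ∀ w ∈ Wm, (gf (bySize (· ≤ 3 - 1) : Finset (Finset α)) * gf (bySize (3 ≤ ·) : Finset (Finset α))).coeff (m - ind w) ≤
      (if w ⊆ dbl m then ((#(lev m 1) : ℤ) + 4) else 0) + (if #(dbl m ∩ w) = 2 then 1 else 0) := fun w hw => by
    obtain ⟨hwW, hwm⟩ := mem_filter.1 hw
    have hwt := hW w hwW
    have hwsupp : w ⊆ m.support := (SahiAllButC.ind_le_iff_subset_support _ _).1 hwm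
    rw [coeff_thetaT_mul_atLeastT_eq_cH (by norm_num) (sub_ind_le_two_of_le_two hm w), dbl_sub_ind_of_le_two hm, sgl_sub_ind_of_le_two hm]
    have hsd : #(dbl m \ w) + #(dbl m ∩ w) = 4 := by rw [card_sdiff_add_card_inter, hD]
    have hdisj : Disjoint (dbl m ∩ w) (lev m 1 \ w) :=
      Disjoint.mono inter_subset_left sdiff_subset (disjoint_dbl_lev_one m)
    by_cases hsub : w ⊆ dbl m
    · have hint : dbl m ∩ w = w := inter_eq_right.2 hsub
      have hTw : lev m 1 \ w = lev m 1 := sdiff_eq_self_of_disjoint ((disjoint_dbl_lev_one m).symm.mono_right hsub)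
      rw [hint] at hsd hdisj ⊢
      rw [if_pos hsub, if_neg (by omega)]
      rw [hTw] at hdisj ⊢
      rw [card_union_of_disjoint hdisj, hwt, show 3 - #(dbl m \ w) = 2 from by omega]
      unfold cH
      rw [show min 2 (3 + #(lev m 1) + 1 - 2) = 2 from by omega]
      simp [sum_range_succ]; omega
    · rw [if_neg hsub]
      have hlt : #(dbl m ∩ w) < 3 := by
        by_contra hge
        have heq : dbl m ∩ w = w := eq_of_subset_of_card_le inter_subset_right (by rw [hwt]; omega)
        exact hsub (by rw [← heq]; exact inter_subset_left)
      by_cases h2 : #(dbl m ∩ w) = 2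
      · rw [if_pos h2, show 3 - #(dbl m \ w) = 1 from by omega]
        unfold cH
        rw [show min 1 (#(dbl m ∩ w ∪ lev m 1 \ w) + 1 - 1) = 1 from by
          have : 1 ≤ #(dbl m ∩ w ∪ lev m 1 \ w) := by
            have := card_le_card (subset_union_left (s₁ := dbl m ∩ w) (s₂ := lev m 1 \ w)); omega
          omega]
        simp
      · rw [if_neg h2, show 3 - #(dbl m \ w) = 0 from by omega]
        unfold cH; simp
  refine (sum_le_sum hval).trans ?_
  rw [sum_add_distrib, sum_boole]
  have e1 : (Wm.filter fun w => w ⊆ dbl m) = W.filter fun w => w ⊆ dbl m := by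
    ext w; simp only [Wm, mem_filter, and_assoc]
    constructor
    · rintro ⟨hw, _, h⟩; exact ⟨hw, h⟩
    · rintro ⟨hw, h⟩; exact ⟨hw, (SahiAllButC.ind_le_iff_subset_support _ _).2 (h.trans (dbl_subset_support m)), h⟩
  rw [← e1]
  have : ∑ w ∈ Wm, (if w ⊆ dbl m then ((#(lev m 1) : ℤ) + 4) else 0) = ((#(lev m 1) : ℤ) + 4) * #(Wm.filter fun w => w ⊆ dbl m) := by
    rw [← sum_filter, sum_const, nsmul_eq_mul]; ring
  rw [this]


/-- **DEG on the 2-live cube at `d`**: for `x ∈ D∖d` with `a_{dx} ≥ 1`, `κ₂(d) ≥ 1 + a_{dx} + c_{dx}`. [this work] -/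
theorem deg_bound_cube_two (h𝒳 : IsUpperSet (𝒳 : Set (Finset α))) (h𝒵 : IsUpperSet (𝒵 : Set (Finset α)))
    (hX3 : ∀ S ∈ 𝒳, 3 ≤ #S) (hZ3 : ∀ S ∈ 𝒵, 3 ≤ #S) {m : α →₀ ℕ} (hD : #(dbl m) = 4) {d x : α} (hd : d ∈ dbl m)
    (hx : x ∈ (dbl m).erase d) (ha : 1 ≤ codegA 𝒳 𝒵 m {d, x}) :
    (1 : ℤ) + codegA 𝒳 𝒵 m {d, x} + cdegC 𝒳 𝒵 m {d, x} ≤ kapTwo 𝒳 𝒵 m d := by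
  unfold codegA cdegC kapTwo at *
  set W := (𝒳 ∩ 𝒵).filter fun S => #S = 3
  have hWsub : ∀ w ∈ W, w ∈ 𝒳 ∧ w ∈ 𝒵 := fun w hw => mem_inter.1 (mem_filter.1 hw).1
  set s := (dbl m).erase d ∪ lev m 1
  have hxd : x ≠ d := (mem_erase.1 hx).1
  have hxs : x ∈ s := mem_union_left _ hx
  have hs3 : 3 ≤ #s := by
    have h1 : #((dbl m).erase d) ≤ #s := card_le_card subset_union_left
    have h2 := card_erase_add_one hd
    omega
  have hsub : ((dbl m \ {d, x}).filter fun u => insert u {d, x} ∈ 𝒳 ∧ insert u {d, x} ∈ 𝒵) ∪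
      ((lev m 1).filter fun y => insert y {d, x} ∈ W) ⊆ cnbrs (upFam d 𝒳) (upFam d 𝒵) s x := by
    intro u hu
    rw [cnbrs, mem_filter, mem_erase, mem_upFam, mem_upFam, ← insert_pair_comm u d x]
    rcases mem_union.1 hu with hu | hu
    · obtain ⟨huD, hX, hZ⟩ := mem_filter.1 hu
      obtain ⟨huD', hudx⟩ := mem_sdiff.1 huD
      have hux : u ≠ x := fun h => hudx (by rw [h]; exact mem_insert_of_mem (mem_singleton_self x))
      have hud : u ≠ d := fun h => hudx (by rw [h]; exact mem_insert_self d _)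
      exact ⟨⟨hux, mem_union_left _ (mem_erase.2 ⟨hud, huD'⟩)⟩, hX, hZ⟩
    · obtain ⟨huT, huW⟩ := mem_filter.1 hu
      have huD : u ∉ dbl m := fun h => disjoint_left.1 (disjoint_dbl_lev_one m) h huT
      have hux : u ≠ x := fun h => huD (h ▸ mem_of_mem_erase hx)
      exact ⟨⟨hux, mem_union_right _ huT⟩, hWsub _ huW⟩
  have hdisj : Disjoint ((dbl m \ {d, x}).filter fun u => insert u {d, x} ∈ 𝒳 ∧ insert u {d, x} ∈ 𝒵)
      ((lev m 1).filter fun y => insert y {d, x} ∈ W) :=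
    Disjoint.mono (filter_subset _ _ |>.trans sdiff_subset) (filter_subset _ _) (disjoint_dbl_lev_one m)
  have hcard := card_le_card hsub
  rw [card_union_of_disjoint hdisj] at hcard
  have hne : (cnbrs (upFam d 𝒳) (upFam d 𝒵) s x).Nonempty := card_pos.1 (by omega)
  have hdeg := card_cnbrs_add_one_le_kap (isUpperSet_upFam h𝒳) (isUpperSet_upFam h𝒵)
    (fun U hU => by have := upFam_live (b := d) hX3 U hU; omega) (fun U hU => by have := upFam_live (b := d) hZ3 U hU; omega)
    (#s) s x rfl hs3 hxs hne
  have : ((#((dbl m \ {d, x}).filter fun u => insert u {d, x} ∈ 𝒳 ∧ insert u {d, x} ∈ 𝒵) : ℕ) : ℤ) +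
      #((lev m 1).filter fun y => insert y {d, x} ∈ W) ≤ #(cnbrs (upFam d 𝒳) (upFam d 𝒵) s x) := by exact_mod_cast hcard
  linarith

omit [Fintype α] in
/-- **LOOP on the 1-live cubes at a pair `p`**: `Σ_{y ∈ T} κ₁(p,y) ≥ τ` if `a_p ≥ 1`, and `≥ c_p` otherwise (`τ ≥ 2`). [this work] -/
theorem loop_bound_cubes_one (h𝒳 : IsUpperSet (𝒳 : Set (Finset α))) (h𝒵 : IsUpperSet (𝒵 : Set (Finset α)))
    (hX3 : ∀ S ∈ 𝒳, 3 ≤ #S) (hZ3 : ∀ S ∈ 𝒵, 3 ≤ #S) {m : α →₀ ℕ} (hτ : 2 ≤ #(lev m 1)) {p : Finset α}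
    (hp : p ∈ (dbl m).powersetCard 2) :
    (if 1 ≤ codegA 𝒳 𝒵 m p then (#(lev m 1) : ℤ) else (cdegC 𝒳 𝒵 m p : ℤ)) ≤ ∑ y ∈ lev m 1, kapOne 𝒳 𝒵 m p y := by
  unfold codegA cdegC kapOne
  set W := (𝒳 ∩ 𝒵).filter fun S => #S = 3
  have hWsub : ∀ w ∈ W, w ∈ 𝒳 ∧ w ∈ 𝒵 := fun w hw => mem_inter.1 (mem_filter.1 hw).1
  obtain ⟨hpD, hp2⟩ := mem_powersetCard.1 hp
  have hpX : p ∉ 𝒳 := fun h => by have := hX3 _ h; omega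
  have hpZ : p ∉ 𝒵 := fun h => by have := hZ3 _ h; omega
  have hk0 : ∀ y, 0 ≤ kap 𝒳 𝒵 p ((dbl m \ p) ∪ (lev m 1).erase y) := fun y =>
    kap_nonneg h𝒳 h𝒵 _ _ (disjoint_union_right.2 ⟨disjoint_sdiff,
      (Disjoint.mono hpD (erase_subset _ _) (disjoint_dbl_lev_one m))⟩)
  split_ifs with ha
  · obtain ⟨u, hu⟩ := card_pos.1 (by omega : 0 < #((dbl m \ p).filter fun u => insert u p ∈ 𝒳 ∧ insert u p ∈ 𝒵))
    obtain ⟨huD, hX, hZ⟩ := mem_filter.1 hu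
    have : ∀ y ∈ lev m 1, (1 : ℤ) ≤ kap 𝒳 𝒵 p ((dbl m \ p) ∪ (lev m 1).erase y) := fun y _ =>
      one_le_kap_cube_one_of_A h𝒳 h𝒵 hX3 hZ3 hp2 huD hX hZ y
    have h := sum_le_sum this
    rw [sum_const, nsmul_eq_mul, mul_one] at h; exact h
  · set C := (lev m 1).filter fun y => insert y p ∈ W
    have hloop : ∀ y, ∀ y' ∈ C, y' ≠ y → (1 : ℤ) ≤ kap 𝒳 𝒵 p ((dbl m \ p) ∪ (lev m 1).erase y) := fun y y' hy' hne => by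
      obtain ⟨hy'T, hy'W⟩ := mem_filter.1 hy'
      exact one_le_kap_of_loop h𝒳 h𝒵 hpX hpZ (mem_union_right _ (mem_erase.2 ⟨hne, hy'T⟩)) (hWsub _ hy'W).1 (hWsub _ hy'W).2
    have hCT : #C ≤ #(lev m 1) := card_filter_le _ _
    rcases Nat.lt_or_ge (#C) 2 with hc | hc
    · rcases Nat.lt_or_ge (#C) 1 with hc0 | hc1
      · rw [show #C = 0 from by omega]; push_cast; exact sum_nonneg fun y _ => hk0 y
      · have hc1 : #C = 1 := by omega
        obtain ⟨y₁, hy₁⟩ := card_eq_one.1 hc1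
        have hy₁C : y₁ ∈ C := by rw [hy₁]; exact mem_singleton_self _
        have hy₁T : y₁ ∈ lev m 1 := (mem_filter.1 hy₁C).1
        rw [hc1, ← add_sum_erase _ _ hy₁T]
        have h1 : ∀ y ∈ (lev m 1).erase y₁, (1 : ℤ) ≤ kap 𝒳 𝒵 p ((dbl m \ p) ∪ (lev m 1).erase y) := fun y hy =>
          hloop y y₁ hy₁C (ne_of_mem_erase hy).symm
        have h2 := sum_le_sum h1
        rw [sum_const, nsmul_eq_mul, mul_one] at h2
        have h3 := hk0 y₁
        have h4 : #((lev m 1).erase y₁) + 1 = #(lev m 1) := card_erase_add_one hy₁T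
        have h5 : (1 : ℤ) ≤ #((lev m 1).erase y₁) := by
          have : 1 ≤ #((lev m 1).erase y₁) := by omega
          exact_mod_cast this
        push_cast; linarith
    · have h1 : ∀ y ∈ lev m 1, (1 : ℤ) ≤ kap 𝒳 𝒵 p ((dbl m \ p) ∪ (lev m 1).erase y) := fun y _ => by
        have hne : (C.erase y).Nonempty := by
          apply card_pos.1
          have := pred_card_le_card_erase (s := C) (a := y)
          omega
        obtain ⟨y', hy'⟩ := hne
        exact hloop y y' (mem_of_mem_erase hy') (ne_of_mem_erase hy')
      have h2 := sum_le_sum h1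
      rw [sum_const, nsmul_eq_mul, mul_one] at h2
      have : (#C : ℤ) ≤ #(lev m 1) := by exact_mod_cast hCT
      linarith

/-- The surplus side contains the cubes of the row: `Σ_d κ₂(d) + Σ_p Σ_y κ₁(p,y) ≤ [m](e_3·H)`. [this work] -/
theorem cubes_le_coeff_ee_mul_harris (h𝒳 : IsUpperSet (𝒳 : Set (Finset α))) (h𝒵 : IsUpperSet (𝒵 : Set (Finset α)))
    {m : α →₀ ℕ} (hm : ∀ i, m i ≤ 2) (hD : #(dbl m) = 4) :
    ∑ d ∈ dbl m, kapTwo 𝒳 𝒵 m d + ∑ p ∈ (dbl m).powersetCard 2, ∑ y ∈ lev m 1, kapOne 𝒳 𝒵 m p y ≤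
      (ee 3 * (PiP * gf (𝒳 ∩ 𝒵) - gf 𝒳 * gf 𝒵)).coeff m := by
  unfold kapTwo kapOne
  have hDT : Disjoint (dbl m) (lev m 1) := disjoint_dbl_lev_one m
  set S₂ := (dbl m).image fun d => (dbl m).erase d with hS₂
  set S₁ := ((dbl m).powersetCard 2 ×ˢ lev m 1).image fun q => insert q.2 (dbl m \ q.1) with hS₁
  have hadm : S₂ ∪ S₁ ⊆ (bySize (· = 3) : Finset (Finset α)).filter fun E => ind E ≤ m := by
    intro E hE
    rw [mem_filter, bySize, mem_filter, SahiAllButC.ind_le_iff_subset_support, support_eq_dbl_union_lev hm]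
    refine ⟨⟨mem_powerset.2 (subset_univ _), ?_⟩, ?_⟩
    · rcases mem_union.1 hE with hE | hE
      · obtain ⟨d, hd, rfl⟩ := mem_image.1 hE
        have := card_erase_add_one hd; omega
      · obtain ⟨q, hq, rfl⟩ := mem_image.1 hE
        obtain ⟨hq1, hq2⟩ := mem_product.1 hq
        obtain ⟨hpD, hp2⟩ := mem_powersetCard.1 hq1
        rw [card_insert_of_notMem (fun h => disjoint_left.1 hDT (mem_sdiff.1 h).1 hq2), card_sdiff_of_subset hpD, hD, hp2]
    · rcases mem_union.1 hE with hE | hE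
      · obtain ⟨d, hd, rfl⟩ := mem_image.1 hE
        exact (erase_subset _ _).trans subset_union_left
      · obtain ⟨q, hq, rfl⟩ := mem_image.1 hE
        obtain ⟨hq1, hq2⟩ := mem_product.1 hq
        exact insert_subset (mem_union_right _ hq2) (sdiff_subset.trans subset_union_left)
  have hdisj : Disjoint S₂ S₁ := by
    rw [disjoint_left]; intro E hE2 hE1
    obtain ⟨d, hd, rfl⟩ := mem_image.1 hE2
    obtain ⟨q, hq, heq⟩ := mem_image.1 hE1
    have hy : q.2 ∈ (dbl m).erase d := by rw [← heq]; exact mem_insert_self _ _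
    exact disjoint_left.1 hDT (mem_of_mem_erase hy) (mem_product.1 hq).2
  have hsur := sum_le_coeff_ee_mul_harris h𝒳 h𝒵 3 m hadm
  have hinj : Set.InjOn (fun q : Finset α × α => insert q.2 (dbl m \ q.1)) ↑((dbl m).powersetCard 2 ×ˢ lev m 1) := by
    intro q hq q' hq' h
    obtain ⟨hq1, hq2⟩ := mem_product.1 (Finset.mem_coe.1 hq)
    obtain ⟨hq1', hq2'⟩ := mem_product.1 (Finset.mem_coe.1 hq')
    have h' : insert q.2 (dbl m \ q.1) = insert q'.2 (dbl m \ q'.1) := h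
    have hy : q.2 = q'.2 := by
      have : q.2 ∈ insert q'.2 (dbl m \ q'.1) := by rw [← h']; exact mem_insert_self _ _
      rcases mem_insert.1 this with h'' | h''
      · exact h''
      · exact absurd (mem_sdiff.1 h'').1 (fun hD' => disjoint_left.1 hDT hD' hq2)
    have hnot : q.2 ∉ dbl m \ q.1 := fun h'' => disjoint_left.1 hDT (mem_sdiff.1 h'').1 hq2
    have hnot' : q'.2 ∉ dbl m \ q'.1 := fun h'' => disjoint_left.1 hDT (mem_sdiff.1 h'').1 hq2'
    have h2 : dbl m \ q.1 = dbl m \ q'.1 := by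
      have h4 : (insert q.2 (dbl m \ q.1)).erase q.2 = (insert q'.2 (dbl m \ q'.1)).erase q'.2 := by rw [h', hy]
      rwa [erase_insert hnot, erase_insert hnot'] at h4
    have h3 : q.1 = q'.1 := by
      rw [← Finset.sdiff_sdiff_eq_self (mem_powersetCard.1 hq1).1, h2, Finset.sdiff_sdiff_eq_self (mem_powersetCard.1 hq1').1]
    exact Prod.ext h3 hy
  rw [sum_union hdisj, sum_image (fun d hd d' hd' h => erase_injOn (dbl m) hd hd' h), sum_image hinj,
    sum_congr rfl fun d hd => coeff_harris_cube_two hm hd,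
    sum_congr rfl fun q hq => coeff_harris_cube_one hm (mem_powersetCard.1 (mem_product.1 hq).1).1 (mem_product.1 hq).2,
    sum_product] at hsur
  exact hsur

/-! #### The theorem -/

/-- **Row `#dbl = 4` of `(L_3)`** (`τ = #(lev m 1) ≥ 2`): for 3-live up-sets `𝒳, 𝒵` and a profile `m ≤ 2` with exactly four doubled points,
`[m] ( e_3·(Π·GF(𝒳∩𝒵) − GF(𝒳)GF(𝒵)) − Θ_2·e_{≥3}·GF((𝒳∩𝒵)_3) ) ≥ 0`. [this work] -/
theorem coeff_ladder_three_rowFour_nonneg (h𝒳 : IsUpperSet (𝒳 : Set (Finset α))) (h𝒵 : IsUpperSet (𝒵 : Set (Finset α)))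
    (hX3 : ∀ S ∈ 𝒳, 3 ≤ #S) (hZ3 : ∀ S ∈ 𝒵, 3 ≤ #S) {m : α →₀ ℕ} (hm : ∀ i, m i ≤ 2) (hD : #(dbl m) = 4)
    (hτ : 2 ≤ #(lev m 1)) :
    0 ≤ (ee 3 * (PiP * gf (𝒳 ∩ 𝒵) - gf 𝒳 * gf 𝒵) -
      gf (bySize (· ≤ 3 - 1) : Finset (Finset α)) * gf (bySize (3 ≤ ·) : Finset (Finset α)) *
        gf ((𝒳 ∩ 𝒵).filter fun S => #S = 3)).coeff m := by
  have hW3 : ∀ w ∈ (𝒳 ∩ 𝒵).filter (fun S => #S = 3), #w = 3 := fun w hw => (mem_filter.1 hw).2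
  have hWsub : ∀ w ∈ (𝒳 ∩ 𝒵).filter (fun S => #S = 3), w ∈ 𝒳 ∧ w ∈ 𝒵 := fun w hw => mem_inter.1 (mem_filter.1 hw).1
  rw [coeff_sub, sub_nonneg]
  refine (coeff_chargeT_rowFour_le hm hD (by omega) _ hW3).trans ((le_trans ?_ (cubes_le_coeff_ee_mul_harris h𝒳 h𝒵 hm hD)))
  -- abbreviations (as equations, not `set`)
  have hWC : (#((((𝒳 ∩ 𝒵).filter fun S => #S = 3).filter fun w => ind w ≤ m).filter fun w => #(dbl m ∩ w) = 2) : ℤ) ≤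
      ∑ p ∈ (dbl m).powersetCard 2, (cdegC 𝒳 𝒵 m p : ℤ) := by
    have := card_WC_le_sum hm ((𝒳 ∩ 𝒵).filter fun S => #S = 3) hW3
    unfold cdegC; exact_mod_cast this
  have hcτ : ∀ p, (cdegC 𝒳 𝒵 m p : ℤ) ≤ #(lev m 1) := fun p => by unfold cdegC; exact_mod_cast card_filter_le _ _
  have hL1 : ∑ p ∈ (dbl m).powersetCard 2, (if 1 ≤ codegA 𝒳 𝒵 m p then (#(lev m 1) : ℤ) else (cdegC 𝒳 𝒵 m p : ℤ)) ≤
      ∑ p ∈ (dbl m).powersetCard 2, ∑ y ∈ lev m 1, kapOne 𝒳 𝒵 m p y :=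
    sum_le_sum fun p hp => loop_bound_cubes_one h𝒳 h𝒵 hX3 hZ3 hτ hp
  have hWDsub : (((𝒳 ∩ 𝒵).filter fun S => #S = 3).filter fun w => w ⊆ dbl m) ⊆ (dbl m).powersetCard 3 := fun w hw =>
    mem_powersetCard.2 ⟨(mem_filter.1 hw).2, hW3 w (mem_filter.1 hw).1⟩
  have hA4 : #(((𝒳 ∩ 𝒵).filter fun S => #S = 3).filter fun w => w ⊆ dbl m) ≤ 4 := by
    have := card_le_card hWDsub; rwa [card_powersetCard, hD] at this
  have hPairs6 : #((dbl m).powersetCard 2) = 6 := by rw [card_powersetCard, hD]; rfl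
  have hτ' : (2 : ℤ) ≤ #(lev m 1) := by exact_mod_cast hτ
  by_cases hA : #(((𝒳 ∩ 𝒵).filter fun S => #S = 3).filter fun w => w ⊆ dbl m) = 4
  · -- TRIANGLE case
    have hall : ∀ w ∈ (dbl m).powersetCard 3, w ∈ 𝒳 ∧ w ∈ 𝒵 := fun w hw => by
      have heq := eq_of_subset_of_card_le hWDsub (by rw [card_powersetCard, hD, hA]; rfl)
      rw [← heq] at hw; exact hWsub w (mem_filter.1 hw).1
    have hS2 : ∑ d ∈ dbl m, ((#(lev m 1) : ℤ) + 4) ≤ ∑ d ∈ dbl m, kapTwo 𝒳 𝒵 m d :=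
      sum_le_sum fun d hd => tri_bound_cube_two h𝒳 h𝒵 hX3 hZ3 hD hd hall
    rw [sum_const, hD, nsmul_eq_mul] at hS2
    have hcov : ∀ p ∈ (dbl m).powersetCard 2, 1 ≤ codegA 𝒳 𝒵 m p := fun p hp => by
      obtain ⟨hpD, hp2⟩ := mem_powersetCard.1 hp
      have hne : (dbl m \ p).Nonempty := card_pos.1 (by rw [card_sdiff_of_subset hpD, hD, hp2]; norm_num)
      obtain ⟨u, hu⟩ := hne
      unfold codegA
      refine card_pos.2 ⟨u, mem_filter.2 ⟨hu, hall _ (mem_powersetCard.2 ⟨insert_subset (mem_sdiff.1 hu).1 hpD, ?_⟩)⟩⟩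
      rw [card_insert_of_notMem (mem_sdiff.1 hu).2, hp2]
    have hL1' : ∑ p ∈ (dbl m).powersetCard 2, (cdegC 𝒳 𝒵 m p : ℤ) ≤
        ∑ p ∈ (dbl m).powersetCard 2, (if 1 ≤ codegA 𝒳 𝒵 m p then (#(lev m 1) : ℤ) else (cdegC 𝒳 𝒵 m p : ℤ)) :=
      sum_le_sum fun p hp => by rw [if_pos (hcov p hp)]; exact hcτ p
    have hA' : (#(((𝒳 ∩ 𝒵).filter fun S => #S = 3).filter fun w => w ⊆ dbl m) : ℤ) = 4 := by exact_mod_cast hA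
    rw [hA']
    push_cast at hS2
    linarith
  · -- DEG case: A ≤ 3
    have hA3 : #(((𝒳 ∩ 𝒵).filter fun S => #S = 3).filter fun w => w ⊆ dbl m) ≤ 3 := by omega
    -- 3 Σ κ₂ ≥ 2 Σ_p g p, g p = [a_p ≥ 1](1 + a_p + c_p)
    have hS2 : ∑ d ∈ dbl m, ∑ x ∈ (dbl m).erase d,
        (if 1 ≤ codegA 𝒳 𝒵 m {d, x} then 1 + (codegA 𝒳 𝒵 m {d, x} : ℤ) + cdegC 𝒳 𝒵 m {d, x} else 0) ≤
        3 * ∑ d ∈ dbl m, kapTwo 𝒳 𝒵 m d := by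
      rw [mul_sum]
      refine sum_le_sum fun d hd => ?_
      have hk : 0 ≤ kapTwo 𝒳 𝒵 m d := by
        unfold kapTwo; exact kap_nonneg (isUpperSet_upFam h𝒳) (isUpperSet_upFam h𝒵) _ _ (disjoint_empty_left _)
      have h1 : ∀ x ∈ (dbl m).erase d, (if 1 ≤ codegA 𝒳 𝒵 m {d, x} then 1 + (codegA 𝒳 𝒵 m {d, x} : ℤ) + cdegC 𝒳 𝒵 m {d, x}
          else 0) ≤ kapTwo 𝒳 𝒵 m d := fun x hx => by
        split_ifs with hax
        · exact deg_bound_cube_two h𝒳 h𝒵 hX3 hZ3 hD hd hx hax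
        · exact hk
      refine (sum_le_sum h1).trans ?_
      rw [sum_const, nsmul_eq_mul]
      have := card_erase_add_one hd
      rw [show #((dbl m).erase d) = 3 from by omega]; push_cast; exact le_rfl
    rw [sum_erase_eq_sum_offDiag (dbl m) (fun d x => if 1 ≤ codegA 𝒳 𝒵 m {d, x} then
        1 + (codegA 𝒳 𝒵 m {d, x} : ℤ) + cdegC 𝒳 𝒵 m {d, x} else 0),
      sum_offDiag_pair_eq (dbl m) (fun p => if 1 ≤ codegA 𝒳 𝒵 m p then 1 + (codegA 𝒳 𝒵 m p : ℤ) + cdegC 𝒳 𝒵 m p else 0)] at hS2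
    -- Σ_p g p = P + Σ_p a_p + Σ_{cov} c_p
    have e1 : ∑ p ∈ (dbl m).powersetCard 2, (if 1 ≤ codegA 𝒳 𝒵 m p then 1 + (codegA 𝒳 𝒵 m p : ℤ) + cdegC 𝒳 𝒵 m p else 0) =
        #(((dbl m).powersetCard 2).filter fun p => 1 ≤ codegA 𝒳 𝒵 m p) + ∑ p ∈ (dbl m).powersetCard 2, (codegA 𝒳 𝒵 m p : ℤ) +
        ∑ p ∈ ((dbl m).powersetCard 2).filter (fun p => 1 ≤ codegA 𝒳 𝒵 m p), (cdegC 𝒳 𝒵 m p : ℤ) := by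
      rw [← sum_filter, sum_add_distrib, sum_add_distrib, sum_const, nsmul_eq_mul, mul_one]
      congr 1; congr 1
      exact sum_filter_of_ne fun p _ h => by
        by_contra h'
        have : codegA 𝒳 𝒵 m p = 0 := by omega
        rw [this] at h; simp at h
    -- Σ_p a_p = 3A
    have hsuma : ∑ p ∈ (dbl m).powersetCard 2, (codegA 𝒳 𝒵 m p : ℤ) = 3 * #(((𝒳 ∩ 𝒵).filter fun S => #S = 3).filter fun w => w ⊆ dbl m) := by
      have e : ∀ p ∈ (dbl m).powersetCard 2, (codegA 𝒳 𝒵 m p : ℤ) =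
          #((((𝒳 ∩ 𝒵).filter fun S => #S = 3).filter fun w => w ⊆ dbl m).filter fun w => p ⊆ w) := fun p hp => by
        obtain ⟨hpD, hp2⟩ := mem_powersetCard.1 hp
        unfold codegA; exact_mod_cast card_filter_insert_eq (𝒳 := 𝒳) (𝒵 := 𝒵) hpD hp2
      rw [sum_congr rfl e]
      have h := sum_card_bipartiteAbove_eq_sum_card_bipartiteBelow (s := (dbl m).powersetCard 2)
        (t := ((𝒳 ∩ 𝒵).filter fun S => #S = 3).filter fun w => w ⊆ dbl m) (r := fun p w => p ⊆ w)
      simp only [bipartiteAbove, bipartiteBelow] at h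
      have h3 : ∀ w ∈ ((𝒳 ∩ 𝒵).filter fun S => #S = 3).filter (fun w => w ⊆ dbl m),
          #(((dbl m).powersetCard 2).filter fun p => p ⊆ w) = 3 := fun w hw => by
        have hwD : w ⊆ dbl m := (mem_filter.1 hw).2
        have : (((dbl m).powersetCard 2).filter fun p => p ⊆ w) = w.powersetCard 2 := by
          ext p; simp only [mem_filter, mem_powersetCard]
          exact ⟨fun h => ⟨h.2, h.1.2⟩, fun h => ⟨⟨h.1.trans hwD, h.2⟩, h.1⟩⟩
        rw [this, card_powersetCard, hW3 w (mem_filter.1 hw).1]; rfl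
      rw [sum_congr rfl h3, sum_const, smul_eq_mul] at h
      have h' : ∑ p ∈ (dbl m).powersetCard 2, #((((𝒳 ∩ 𝒵).filter fun S => #S = 3).filter fun w => w ⊆ dbl m).filter fun w => p ⊆ w) =
          3 * #(((𝒳 ∩ 𝒵).filter fun S => #S = 3).filter fun w => w ⊆ dbl m) := by rw [h, mul_comm]
      exact_mod_cast h'
    -- P = 3A − C(A,2) ≥ 2A
    have hP : (#(((dbl m).powersetCard 2).filter fun p => 1 ≤ codegA 𝒳 𝒵 m p) : ℤ) =
        3 * #(((𝒳 ∩ 𝒵).filter fun S => #S = 3).filter fun w => w ⊆ dbl m) -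
          (#(((𝒳 ∩ 𝒵).filter fun S => #S = 3).filter fun w => w ⊆ dbl m)).choose 2 := by
      have h := card_covered_pairs hD ((𝒳 ∩ 𝒵).filter fun S => #S = 3) hW3
      have hfilt : (((dbl m).powersetCard 2).filter fun p => 1 ≤ #((dbl m \ p).filter fun u =>
          insert u p ∈ (𝒳 ∩ 𝒵).filter fun S => #S = 3)) = ((dbl m).powersetCard 2).filter fun p => 1 ≤ codegA 𝒳 𝒵 m p := by
        refine filter_congr fun p hp => ?_
        obtain ⟨hpD, hp2⟩ := mem_powersetCard.1 hp
        unfold codegA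
        rw [filter_congr (s := dbl m \ p) (q := fun u => insert u p ∈ 𝒳 ∧ insert u p ∈ 𝒵) fun u hu => by
          rw [mem_filter, mem_inter, card_insert_of_notMem (mem_sdiff.1 hu).2, hp2]; tauto]
      rw [hfilt] at h; exact h
    have hchoose : ((#(((𝒳 ∩ 𝒵).filter fun S => #S = 3).filter fun w => w ⊆ dbl m)).choose 2 : ℤ) ≤
        #(((𝒳 ∩ 𝒵).filter fun S => #S = 3).filter fun w => w ⊆ dbl m) := by
      have : ∀ n : ℕ, n ≤ 3 → n.choose 2 ≤ n := by decide
      exact_mod_cast this _ hA3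
    -- Σ c split and the covered part ≤ τ P
    have hcsplit := (sum_filter_add_sum_filter_not ((dbl m).powersetCard 2) (fun p => 1 ≤ codegA 𝒳 𝒵 m p)
      (fun p => (cdegC 𝒳 𝒵 m p : ℤ)))
    have hL1split : ∑ p ∈ (dbl m).powersetCard 2, (if 1 ≤ codegA 𝒳 𝒵 m p then (#(lev m 1) : ℤ) else (cdegC 𝒳 𝒵 m p : ℤ)) =
        (#(lev m 1) : ℤ) * #(((dbl m).powersetCard 2).filter fun p => 1 ≤ codegA 𝒳 𝒵 m p) +
          ∑ p ∈ ((dbl m).powersetCard 2).filter (fun p => ¬ 1 ≤ codegA 𝒳 𝒵 m p), (cdegC 𝒳 𝒵 m p : ℤ) := by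
      rw [sum_ite, sum_const, nsmul_eq_mul]; ring
    have hccov : ∑ p ∈ ((dbl m).powersetCard 2).filter (fun p => 1 ≤ codegA 𝒳 𝒵 m p), (cdegC 𝒳 𝒵 m p : ℤ) ≤
        (#(lev m 1) : ℤ) * #(((dbl m).powersetCard 2).filter fun p => 1 ≤ codegA 𝒳 𝒵 m p) := by
      have := sum_le_sum (s := ((dbl m).powersetCard 2).filter fun p => 1 ≤ codegA 𝒳 𝒵 m p) fun p _ => hcτ p
      rw [sum_const, nsmul_eq_mul] at this; linarith
    have hA0 : (0 : ℤ) ≤ #(((𝒳 ∩ 𝒵).filter fun S => #S = 3).filter fun w => w ⊆ dbl m) := Nat.cast_nonneg _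
    nlinarith [hS2, e1, hP, hsuma, hchoose, hcsplit, hL1split, hccov, hL1, hWC, hτ', hA0,
      mul_nonneg (sub_nonneg.2 hτ') hA0]

end RowFourMain

end Summit.CriticalPhenomena.PercolationContinuityZ3.Theorems.SahiCTCForms
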